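import Summits.KontsevichZagierPeriods.KontsevichZagierPeriods.Theses.HurwitzMicroSectors
import Summits.KontsevichZagierPeriods.KontsevichZagierPeriods.Theorems.MzvKernelInKZ.Negative.ZetaTwo
import Literature.NumberTheory.Transcendental.KZRelationsLE

/-!
# Crux `HurwitzSectorComplement` (stmt-KontsevichZagierPeriods-14341) — ideator 1, round 1: typed first lemmas

Sketch file for the two crux idea cards

* `rotation-torus-even-chains` (§1): the weight-2 EVEN cyclotomic evaluations
  `Re Li₂(e^{2πia/N}) = π² B₂(a/N)` as KZ chains — Poisson certificate `∂ₛΦ = ∂_yΨ`,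
  the angle chart `(x,s) ↦ (tan(α/2), tan(χ/2))` with Jacobian EXACTLY `1/(x² − 2sx + 1)`,
  and the grid dissection of the angle region against the tree's `G2 = Q²` (value `π²/4`);
  emblematic complement instance: the level-5 GOLDEN TWIST `e₁ ∼ φ²·e₂`.
* `algebraic-scalars-f-hull` (§2): `KZ.scale` makes `FormalRep ⧸ relations` a vector space over the
  real algebraic numbers `F`; the first complement rung above the closed `(2,6)` sector is its
  `F`-hull, priced by `F`-linear independence of `1, π², L(2,χ₋₃)`.

Nothing here is proved (crux-ideate files no skeleton); every `def … : Prop` elaborates.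
-/

noncomputable section

set_option linter.dupNamespace false

namespace Summit.KontsevichZagierPeriods.KontsevichZagierPeriods.Cruxes.HurwitzSectorComplement.SketchIdeator1

open Set MeasureTheory
open Literature.NumberTheory.Transcendental
open Summit.KontsevichZagierPeriods.MzvKernelInKZ.Negative (G2)

/-- The open unit box `(0,1)ⁿ`, as in the route file. -/
def box (n : ℕ) : Set (Fin n → ℝ) := {x | ∀ i, x i ∈ Set.Ioo (0:ℝ) 1}

/-! ## §1 `rotation-torus-even-chains` -/

/-- The Poisson even piece `P_c(t) = (c − t)/(1 − 2ct + t²) = Re (ζ/(1 − ζ t))`, `ζ = c + i√(1−c²)`. -/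
def poissonEven (c t : ℝ) : ℝ := (c - t) / (1 - 2 * c * t + t ^ 2)

/-- STEP 1 (three moves: Newton–Leibniz in the parameter `s` from the Euler anchor `s = 1`,
a coordinate permutation, Newton–Leibniz in `y` with the RATIONAL primitive
`y/(1 − 2sxy + x²y²)`): `[box₂, P_c(xy)] − [box₂, 1/(1−xy)] + [K_c] ∈ relations`, where
`K_c = [{0<x<1, c<s<1}, 1/(1 − 2sx + x²)]`.  Valid for every real algebraic `c ∈ (−1,1)`. -/
def PoissonReduction : Prop :=
  ∀ (c : ℝ), IsAlgebraic ℚ c → c ∈ Set.Ioo (-1:ℝ) 1 →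
  ∀ (r rz rk : KZ.IntegralRep 2),
    r.domain = box 2 → Set.EqOn r.integrand (fun x => poissonEven c (x 0 * x 1)) r.domain →
    rz.domain = box 2 → Set.EqOn rz.integrand (fun x => 1 / (1 - x 0 * x 1)) rz.domain →
    rk.domain = {x | x 0 ∈ Set.Ioo (0:ℝ) 1 ∧ x 1 ∈ Set.Ioo c 1} →
    Set.EqOn rk.integrand (fun x => 1 / (1 - 2 * x 1 * x 0 + x 0 ^ 2)) rk.domain →
    KZ.of r - KZ.of rz + KZ.of rk ∈ KZ.relations

/-- STEP 2 (ONE change-of-variables move, the ANGLE CHART): with `s = cos α`,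
`ψ = arg(e^{iα} − x)`, `χ = 2ψ − α`, the map `(x,s) ↦ (tan(α/2), tan(χ/2))` is `ℚ`-semialgebraic,
injective on `{0<x<1, c<s<1}`, and `dα dψ = dx ds/(x² − 2sx + 1)` EXACTLY (sympy-certified,
job j012073), so `K_c` is ONE move away from the angle region
`R'_c = {(a,b) | 0 < a < tan(θ/2), a < b}` (`c = cos θ`) with integrand `½·g(a)g(b)`,
`g(t) = 2/(1+t²)` (the tree's `Qrep` density). -/
def AngleChart : Prop :=
  ∀ (c : ℝ), IsAlgebraic ℚ c → c ∈ Set.Ioo (-1:ℝ) 1 →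
  ∀ (rk ra : KZ.IntegralRep 2),
    rk.domain = {x | x 0 ∈ Set.Ioo (0:ℝ) 1 ∧ x 1 ∈ Set.Ioo c 1} →
    Set.EqOn rk.integrand (fun x => 1 / (1 - 2 * x 1 * x 0 + x 0 ^ 2)) rk.domain →
    ra.domain = {z | 0 < z 0 ∧ z 0 < Real.sqrt ((1 - c) / (1 + c)) ∧ z 0 < z 1} →
    Set.EqOn ra.integrand (fun z => (1 / 2) * (2 / (1 + z 0 ^ 2)) * (2 / (1 + z 1 ^ 2))) ra.domain →
    KZ.of rk - KZ.of ra ∈ KZ.changeOfVariablesRel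

/-- STEP 3 (GRID DISSECTION at a cyclotomic angle `θ = 2πa/N`): the angle region is a union of
`8a(N−a)` half-open grid cells of angular size `(π/2N)²` (rectangle + triangle; the two kinds of
diagonal half-cells are swapped by `(a,b) ↦ (b,a)`), each carried onto a reference cell by the
finite-order Möbius ROTATIONS `t ↦ (t cos(π/2N) + sin(π/2N))/(−t sin(π/2N) + cos(π/2N))`
(real-algebraic coefficients, preserving `g(t)dt`), while the tree's `G2 = Q²` (`(0,π/2)²` in
half-angle coordinates, value `π²/4`) is `N²` cells: `N²·[R'] ≡ 4a(N−a)·[G2]`. -/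
def GridDissection : Prop :=
  ∀ (N a : ℕ), 0 < a → 2 * a < N →
  ∀ (ra : KZ.IntegralRep 2),
    ra.domain = {z | 0 < z 0 ∧ z 0 < Real.tan (Real.pi * a / N) ∧ z 0 < z 1} →
    Set.EqOn ra.integrand (fun z => (1 / 2) * (2 / (1 + z 0 ^ 2)) * (2 / (1 + z 1 ^ 2))) ra.domain →
    ((N : ℤ) ^ 2) • KZ.of ra - ((4 * a * (N - a) : ℕ) : ℤ) • KZ.of G2 ∈ KZ.relations

/-- THE EVEN EVALUATION CHAIN (assembled from steps 1–3, the tree's Euler chain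
`three_zeta_two_sub_two_G2_mem : 3·[Δ₂,ω₀₁] ≡ 2·[G2]`, its cubical chart, and torsion-freeness):
`N²·[box₂, P_{cos(2πa/N)}(xy)] ≡ (N² − 6aN + 6a²)·[box₂, 1/(1−xy)]`, i.e.
`Re Li₂(e^{2πia/N}) = 6 B₂(a/N) ζ(2)` INSIDE the calculus. -/
def EvenPoissonEvaluation : Prop :=
  ∀ (N a : ℕ), 0 < a → 2 * a < N →
  ∀ (r rz : KZ.IntegralRep 2),
    r.domain = box 2 →
    Set.EqOn r.integrand (fun x => poissonEven (Real.cos (2 * Real.pi * a / N)) (x 0 * x 1)) r.domain →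
    rz.domain = box 2 → Set.EqOn rz.integrand (fun x => 1 / (1 - x 0 * x 1)) rz.domain →
    ((N : ℤ) ^ 2) • KZ.of r - ((N : ℤ) ^ 2 - 6 * a * N + 6 * a ^ 2) • KZ.of rz ∈ KZ.relations

/-- THE EMBLEMATIC COMPLEMENT PAIR (level 5, the golden twist): the rational 2-dim box
representation of `e₁/25 = (ζ(2,1/5) + ζ(2,4/5))/25 = ∫∫ (1+t³)/(1−t⁵)` and the rational
3-dim representation of `φ²·e₂/25`, `φ² = (3+√5)/2`, `e₂/25 = ∫∫ (t+t²)/(1−t⁵)`, have EQUAL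
values (`e₁ = φ² e₂`, to 30 digits, job j012073) and are KZ-equivalent — an identity that NO
combination of dilations (distribution relations) proves (Kubert: `e₁`, `e₂` are independent in
the universal distribution), obtained from `EvenPoissonEvaluation` at `N = 5`, cyclotomic partial
fractions over `ℚ(√5)` (rule 1b) and additivity of `KZ.scale` in the scalar. -/
def GoldenTwist : Prop :=
  ∀ (r : KZ.IntegralRep 2) (r' : KZ.IntegralRep 3),
    r.domain = box 2 →
    Set.EqOn r.integrand (fun x => (1 + (x 0 * x 1) ^ 3) / (1 - (x 0 * x 1) ^ 5)) r.domain →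
    r'.domain = {z | z 0 ∈ Set.Ioo (0:ℝ) 1 ∧ z 1 ∈ Set.Ioo (0:ℝ) 1 ∧ 0 < z 2 ∧ z 2 < (3 + Real.sqrt 5) / 2} →
    Set.EqOn r'.integrand (fun z => (z 0 * z 1 + (z 0 * z 1) ^ 2) / (1 - (z 0 * z 1) ^ 5)) r'.domain →
    KZ.Equivalent r r'

/-- THE UNCONDITIONAL RUNG (even weight-2 cyclotomic sector, ALL levels, transcendence input =
Lindemann only): two rational box representations whose integrands are EVEN cyclotomic
combinations `Σ_a q_a (t^{a-1} + t^{N-a-1})/(1 − t^N) + polynomial` with equal values are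
KZ-equivalent.  (Typed here for a single level `N` and coefficient vectors `q, q'`.) -/
def EvenCyclotomicSector : Prop :=
  ∀ (N : ℕ), 2 ≤ N → ∀ (q q' : Fin (N - 1) → ℚ) (p p' : Polynomial ℚ) (r r' : KZ.IntegralRep 2),
    r.domain = box 2 → r'.domain = box 2 →
    Set.EqOn r.integrand (fun x => (∑ a : Fin (N - 1), (q a : ℝ) *
        ((x 0 * x 1) ^ (a : ℕ) + (x 0 * x 1) ^ (N - 2 - (a : ℕ))) / (1 - (x 0 * x 1) ^ N))
        + Polynomial.aeval (x 0 * x 1) p) r.domain →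
    Set.EqOn r'.integrand (fun x => (∑ a : Fin (N - 1), (q' a : ℝ) *
        ((x 0 * x 1) ^ (a : ℕ) + (x 0 * x 1) ^ (N - 2 - (a : ℕ))) / (1 - (x 0 * x 1) ^ N))
        + Polynomial.aeval (x 0 * x 1) p') r'.domain →
    r.value = r'.value → KZ.Equivalent r r'

/-- THE CLAUSEN LADDER AS EXACTNESS (all weights): `∂_θ[ζ/(1−ζt)] = i·∂_t[t·ζ/(1−ζt)]`, hence
`∂_θ Im = ∂_{x_w}[x_w·Re]`, `∂_θ Re = −∂_{x_w}[x_w·Im]` (sympy-certified, job j012319): the same two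
moves as in weight 2 lower the weight by one, so by induction every Bernoulli-parity cyclotomic value
is a chain over angular ORDER-SIMPLEX dissections (pieces congruent under coordinate permutations and
grid rotations).  Typed instance, weight 3: `Im Li₃(e^{2πia/N}) = π³·a(N−a)(N−2a)/(3N³)`, i.e.
`3N³·[box₃, sin θ/(1 − 2cos θ·t + t²)] ≡ 8a(N−a)(N−2a)·[Q³]` (`Q³ = Qrep³`, value `π³/8`). -/
def OddPoissonEvaluationWeightThree : Prop :=
  ∀ (N a : ℕ), 0 < a → 2 * a < N →
  ∀ (r : KZ.IntegralRep 3),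
    r.domain = box 3 →
    Set.EqOn r.integrand (fun x => Real.sin (2 * Real.pi * a / N) /
      (1 - 2 * Real.cos (2 * Real.pi * a / N) * (x 0 * x 1 * x 2) + (x 0 * x 1 * x 2) ^ 2)) r.domain →
    ((3 * N ^ 3 : ℕ) : ℤ) • KZ.of r
      - ((8 * a * (N - a) * (N - 2 * a) : ℕ) : ℤ) •
        KZ.of (Summit.KontsevichZagierPeriods.MzvKernelInKZ.Negative.Qrep.prod
          (Summit.KontsevichZagierPeriods.MzvKernelInKZ.Negative.Qrep.prod
            Summit.KontsevichZagierPeriods.MzvKernelInKZ.Negative.Qrep)) ∈ KZ.relations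

/-! ## §2 `algebraic-scalars-f-hull` -/

/-- `KZ.scale` is ADDITIVE IN THE SCALAR modulo relations (one integrand-additivity move per
generator): together with `scale_mem_relations`, `eval_scale` and `scale (ab) = scale a ∘ scale b`
this makes `FormalRep ⧸ relations` a vector space over the field `F` of real algebraic numbers and
`eval` an `F`-linear map. -/
def ScaleAddSub : Prop :=
  ∀ (a b : ℝ) (ha : IsAlgebraic ℚ a) (hb : IsAlgebraic ℚ b) (c : KZ.FormalRep),
    KZ.scale (a + b) (ha.add hb) c - KZ.scale a ha c - KZ.scale b hb c ∈ KZ.relations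

/-- Multiplicativity of `KZ.scale` (holds on the nose; stated modulo relations). -/
def ScaleMulSub : Prop :=
  ∀ (a b : ℝ) (ha : IsAlgebraic ℚ a) (hb : IsAlgebraic ℚ b) (c : KZ.FormalRep),
    KZ.scale (a * b) (ha.mul hb) c - KZ.scale a ha (KZ.scale b hb c) ∈ KZ.relations

/-- A scalar is ONE Newton–Leibniz move: `[σ, α f] ≡ [σ × (0,α), f ∘ init]` (primitive
`F(x,t) = t·f(x)`), so every real-algebraic rescaling of a rational representation is again the
class of a RATIONAL representation one dimension up — the complement contains the `F`-hull of
every sector. -/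
def ScalarUnfolding : Prop :=
  ∀ (n : ℕ) (α : ℝ) (hα : IsAlgebraic ℚ α), 0 < α →
  ∀ (r : KZ.IntegralRep n) (r' : KZ.IntegralRep (n + 1)),
    r'.domain = {z | (Fin.init z : Fin n → ℝ) ∈ r.domain ∧ 0 < z (Fin.last n) ∧ z (Fin.last n) < α} →
    Set.EqOn r'.integrand (fun z => r.integrand (Fin.init z)) r'.domain →
    KZ.of r' - KZ.scale α hα (KZ.of r) ∈ KZ.relations

/-- The `L`-value of the route, `L(2,χ₋₃) = Σ (1/(3n+1)² − 1/(3n+2)²)`. -/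
def Lchi3 : ℝ := ∑' n : ℕ, (1 / (3 * (n : ℝ) + 1) ^ 2 - 1 / (3 * (n : ℝ) + 2) ^ 2)

/-- THE PRICE of the first complement rung above `(2,6)` (OPEN; strictly between
Calegari–Dimitrov–Tang's `ℚ`-linear independence and GPC; CDT Rem. 108 gives the formal
number-field version of the holonomy bound, not this statement; for `F ∋ √3` it contains
"`Vol(Gieseking) = (3√3/4)·L(2,χ₋₃) ∉ ℚ + ℚπ²`", printed as open on CDT p. 3):
`1, π², L(2,χ₋₃)` are linearly independent over the real algebraic numbers. -/
def FIndepTwoSix : Prop :=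
  ∀ (a b c : ℝ), IsAlgebraic ℚ a → IsAlgebraic ℚ b → IsAlgebraic ℚ c →
    a + b * Real.pi ^ 2 + c * Lchi3 = 0 → a = 0 ∧ b = 0 ∧ c = 0

/-- THE `F`-HULL RUNG: under `FIndepTwoSix`, Conjecture 1 holds for every pair of RATIONAL
3-dimensional representations `[box₂ × (0,α), P(xy)/(1−(xy)⁶)]`, `[box₂ × (0,α'), P'(xy)/(1−(xy)⁶)]`
(`α, α' > 0` real algebraic, `P, P' ∈ ℚ[t]`) — the real-algebraic rescalings of the closed `(2,6)`
sector, which the route's `ℚ`-linear CDT input does NOT close. Reduction: `ScalarUnfolding` +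
`ReductionTwoSix` (closed) + `ScaleAddSub`; rigidity: `FIndepTwoSix`. -/
def FHullSectorTwoSix : Prop :=
  FIndepTwoSix →
  ∀ (α α' : ℝ), IsAlgebraic ℚ α → IsAlgebraic ℚ α' → 0 < α → 0 < α' →
  ∀ (P P' : Polynomial ℚ) (r r' : KZ.IntegralRep 3),
    r.domain = {z | z 0 ∈ Set.Ioo (0:ℝ) 1 ∧ z 1 ∈ Set.Ioo (0:ℝ) 1 ∧ 0 < z 2 ∧ z 2 < α} →
    r'.domain = {z | z 0 ∈ Set.Ioo (0:ℝ) 1 ∧ z 1 ∈ Set.Ioo (0:ℝ) 1 ∧ 0 < z 2 ∧ z 2 < α'} →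
    Set.EqOn r.integrand (fun z => Polynomial.aeval (z 0 * z 1) P / (1 - (z 0 * z 1) ^ 6)) r.domain →
    Set.EqOn r'.integrand (fun z => Polynomial.aeval (z 0 * z 1) P' / (1 - (z 0 * z 1) ^ 6)) r'.domain →
    r.value = r'.value → KZ.Equivalent r r'

/-- DIAGNOSTIC (provable, disprover-facing): a separating invariant may be taken `F`-LINEAR —
if Conjecture 1 fails there is an additive `J` killing `relations`, compatible with every `scale α`,
and non-zero on some value-zero combination. (Sharpens the sibling Disproof §4 template, where `J`
is only `ℚ`-linear.) -/
def FLinearSeparation : Prop :=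
  ¬ KontsevichZagierPeriods →
    ∃ J : KZ.FormalRep →+ ℝ, (∀ c ∈ KZ.relations, J c = 0) ∧
      (∀ (a : ℝ) (ha : IsAlgebraic ℚ a) (c : KZ.FormalRep), J (KZ.scale a ha c) = a * J c) ∧
      ∃ c : KZ.FormalRep, KZ.eval c = 0 ∧ J c ≠ 0

/-! ## How the two cards would sit in a concluding skeleton (honesty clause)

Modulo its antecedents the crux IS the summit (refuter Probe: item ↔ (SectorTwoSix → summit)), so
every concluding skeleton carries one summit-strength stub; the cards enlarge the CLOSED region
(`EvenCyclotomicSector` unconditionally, `FHullSectorTwoSix` conditionally on a named open price)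
and change the coordinates of the remainder (`F`-linear normal forms). -/

/-- The remainder after the two cards, in `F`-linear normal-form coordinates (summit strength,
declared). -/
def FNormalFormPrinciple : Prop :=
  ∃ 𝒩 : (n : ℕ) → Set (KZ.IntegralRep n),
    (∀ (n : ℕ) (a : ℝ) (ha : IsAlgebraic ℚ a) (N : KZ.IntegralRep n), N ∈ 𝒩 n →
      ∃ (m : ℕ) (N' : KZ.IntegralRep m), N' ∈ 𝒩 m ∧ KZ.of N' - KZ.scale a ha (KZ.of N) ∈ KZ.relations) ∧
    (∀ (n m : ℕ) (N : KZ.IntegralRep n) (N' : KZ.IntegralRep m), N ∈ 𝒩 n → N' ∈ 𝒩 m →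
      N.value = N'.value → KZ.Equivalent N N') ∧
    (∀ (n : ℕ) (r : KZ.IntegralRep n), r.IsRational →
      ∃ (m : ℕ) (N : KZ.IntegralRep m), N ∈ 𝒩 m ∧ KZ.Equivalent r N)

/-- The converse direction `NormalFormPrinciple → FNormalFormPrinciple` (same `𝒩`; `F`-stability from
the tree fact `KZ.exists_isRational_equivalent` — every representation, in particular `N.constMul a`,
is move-equivalent to a rational one — followed by reduction). Stated, not proved here. -/
def FNormalFormPrinciple_of_normalFormPrinciple : Prop :=
  Summit.KontsevichZagierPeriods.KontsevichZagierPeriods.Theses.HurwitzMicroSectors.NormalFormPrinciple →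
    FNormalFormPrinciple

/-- `F`-stable normal forms imply the route's target (forget the `F`-stability clause). -/
theorem normalFormPrinciple_of_F (h : FNormalFormPrinciple) :
    Summit.KontsevichZagierPeriods.KontsevichZagierPeriods.Theses.HurwitzMicroSectors.NormalFormPrinciple := by
  obtain ⟨𝒩, -, hrig, hred⟩ := h
  exact ⟨𝒩, hrig, hred⟩

/-- Hence the crux from the `F`-form (the two Hurwitz antecedents are idle, as the refuter's Probe shows). -/
theorem hurwitzSectorComplement_of_F (h : FNormalFormPrinciple) :
    Summit.KontsevichZagierPeriods.KontsevichZagierPeriods.Theses.HurwitzMicroSectors.HurwitzSectorComplement :=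
  fun _ _ => normalFormPrinciple_of_F h

end Summit.KontsevichZagierPeriods.KontsevichZagierPeriods.Cruxes.HurwitzSectorComplement.SketchIdeator1
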